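import Summits.KontsevichZagierPeriods.Zeta5Search.TwoTaleP15SecondTaleBAssembly
import Summits.KontsevichZagierPeriods.Zeta5Search.WellPoisedFaceEnvelope

/-!
# The two-tale point P15: the δ-refined Lemma 8 for `B_k` (zone β₂) and a termwise assembly for `p̂`

HONEST FRAMING: systematic search; no irrationality claim unless certified.

Cell pub-zeta5, T3 service (fam-denom D16, the two-decay / (bmiss)-free closing of `families/denom/P15KERNEL.md`
§10 as corrected in `pub-zeta5-p1/TWODECAY-ROUTE-g10.md`).  Denominator side only; nothing about irrationality.

* **`padicNorm_coefBT_zoneB2_sharp`** — on `16n+1 ≤ k ≤ 24n+1` (`26n < p²`): if NO linear-factor value of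
  `R̂(t)(t+k)²` at `t = −k` is divisible by `p` — in digits: `⌊(2k−15n−2)/p⌋ = ⌊(2k−32n−2)/p⌋`,
  `⌊(k−6n−1)/p⌋ = ⌊(k−11n−1)/p⌋`, `⌊(k−13n−1)/p⌋ = ⌊(24n+1−k)/p⌋ = ⌊(k−15n−1)/p⌋ = ⌊(26n+1−k)/p⌋ = 0` — then the
  logarithmic derivative is `p`-integral and `‖B_k‖_p ≤ ‖A_k‖_p ≤ p^{−E(k)}`, one power of `p` better than the tree's
  `padicNorm_coefBT_zoneB2` (`p^{1−E(k)}`), whose proof this one follows with carry exponent `j = 0`.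
* `padicNorm_harmAlt2_le_one` / `padicNorm_harmAlt1_le_one` — the truncated alternating sums of length `< p` are
  `p`-integral.
* **`padicNorm_formPT_le_of_termwise`** — `‖p̂_n‖_p ≤ p^e` from TERMWISE bounds
  `‖A_k‖_p·‖harmAlt2(2k−26n−2)‖_p ≤ p^e` (`16n+1 ≤ k ≤ 24n+1`) and `‖B_k‖_p·‖harmAlt1(2k−26n−2)‖_p ≤ p^e`
  (`15n+1 ≤ k ≤ 26n+1`); the tree's `padicNorm_formPT_le` is the uniform special case.
* `EZ_nonneg`, `EZ_le_four` — `E(k)` is a sum of four base-`p` carries (`WellPoisedFace.ediv_add_carry`).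
-/

noncomputable section

namespace Summit.KontsevichZagierPeriods.Zeta5Search.TwoTaleP15

open Finset Polynomial
open Literature.NumberTheory.Irrationality.Zudilin2014

section Carries

/-- `0 ≤ E(k)`: each of the four brackets of `EZ` is a carry. -/
theorem EZ_nonneg {p : ℕ} (hp0 : 0 < p) (n : ℕ) (k : ℤ) : 0 ≤ EZ p n k := by
  have hp' : (0 : ℤ) < p := by exact_mod_cast hp0
  have c1 := WellPoisedFace.ediv_add_carry (2 * k - (32 * (n : ℤ) + 2)) (17 * n) hp'
  have c2 := WellPoisedFace.ediv_add_carry (k - (11 * (n : ℤ) + 1)) (5 * n) hp'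
  have c3 := WellPoisedFace.ediv_add_carry (k - (13 * (n : ℤ) + 1)) (24 * n + 1 - k) hp'
  have c4 := WellPoisedFace.ediv_add_carry (k - (15 * (n : ℤ) + 1)) (26 * n + 1 - k) hp'
  have e1 : 2 * k - (32 * (n : ℤ) + 2) + 17 * n = 2 * k - (15 * n + 2) := by ring
  have e2 : k - (11 * (n : ℤ) + 1) + 5 * n = k - (6 * n + 1) := by ring
  have e3 : k - (13 * (n : ℤ) + 1) + (24 * n + 1 - k) = 11 * n := by ring
  have e4 : k - (15 * (n : ℤ) + 1) + (26 * n + 1 - k) = 11 * n := by ring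
  rw [e1] at c1; rw [e2] at c2; rw [e3] at c3; rw [e4] at c4
  unfold EZ; omega

/-- `E(k) ≤ 4`. -/
theorem EZ_le_four {p : ℕ} (hp0 : 0 < p) (n : ℕ) (k : ℤ) : EZ p n k ≤ 4 := by
  have hp' : (0 : ℤ) < p := by exact_mod_cast hp0
  have c1 := WellPoisedFace.ediv_add_carry (2 * k - (32 * (n : ℤ) + 2)) (17 * n) hp'
  have c2 := WellPoisedFace.ediv_add_carry (k - (11 * (n : ℤ) + 1)) (5 * n) hp'
  have c3 := WellPoisedFace.ediv_add_carry (k - (13 * (n : ℤ) + 1)) (24 * n + 1 - k) hp'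
  have c4 := WellPoisedFace.ediv_add_carry (k - (15 * (n : ℤ) + 1)) (26 * n + 1 - k) hp'
  have e1 : 2 * k - (32 * (n : ℤ) + 2) + 17 * n = 2 * k - (15 * n + 2) := by ring
  have e2 : k - (11 * (n : ℤ) + 1) + 5 * n = k - (6 * n + 1) := by ring
  have e3 : k - (13 * (n : ℤ) + 1) + (24 * n + 1 - k) = 11 * n := by ring
  have e4 : k - (15 * (n : ℤ) + 1) + (26 * n + 1 - k) = 11 * n := by ring
  rw [e1] at c1; rw [e2] at c2; rw [e3] at c3; rw [e4] at c4
  unfold EZ; omega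

end Carries

section Sharp

variable {n : ℕ} {p : ℕ} [hp : Fact p.Prime]

/-- No multiple of `p` among `pc`-candidates: if `⌊B/p⌋ = ⌊A/p⌋` with `A < v ≤ B`... in the form used below:
for `0 < p`, `lo ≤ v ≤ hi`, `lo > 0`... we state it directly: if `x/p = y/p` and `y < v ≤ x` then `¬ p ∣ v`
fails only... (helper) `y < c·p ≤ x` is impossible when `x/p = y/p`. -/
theorem no_mult_between {x y : ℤ} {p : ℤ} (hp : 0 < p) (hxy : x / p = y / p) {c : ℤ} (h1 : y < c * p)
    (h2 : c * p ≤ x) : False := by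
  have a : c ≤ x / p := (Int.le_ediv_iff_mul_le hp).2 h2
  have b : y / p < c := (Int.ediv_lt_iff_lt_mul hp).2 h1
  omega

/-- **Zone β₂, δ-refined** (`16n+1 ≤ k ≤ 24n+1`, any prime `p`): if no linear-factor value of `R̂(t)(t+k)²` at
`t = −k` is divisible by `p` (digit form, see the module docstring), then `‖B_k‖_p ≤ p^{−E(k)}`. -/
theorem padicNorm_coefBT_zoneB2_sharp (hn : 1 ≤ n) {k : ℤ}
    (h1 : 16 * (n : ℤ) + 1 ≤ k) (h2 : k ≤ 24 * (n : ℤ) + 1)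
    (d0 : (2 * k - (15 * (n : ℤ) + 2)) / (p : ℤ) = (2 * k - (32 * (n : ℤ) + 2)) / (p : ℤ))
    (d1 : (k - (6 * (n : ℤ) + 1)) / (p : ℤ) = (k - (11 * (n : ℤ) + 1)) / (p : ℤ))
    (d2 : (k - (13 * (n : ℤ) + 1)) / (p : ℤ) = 0 ∧ (24 * (n : ℤ) + 1 - k) / (p : ℤ) = 0)
    (d3 : (k - (15 * (n : ℤ) + 1)) / (p : ℤ) = 0 ∧ (26 * (n : ℤ) + 1 - k) / (p : ℤ) = 0) :
    padicNorm p (coefBT (aT n) (bT n) k) ≤ (p : ℚ) ^ (-EZ p n k) := by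
  have hp0 : (p : ℚ) ≠ 0 := by exact_mod_cast hp.out.ne_zero
  have hpz : (0 : ℤ) < p := by exact_mod_cast hp.out.pos
  have hD2 : k ∈ Ico (aT n 2) (bT n 2) := by simp [mem_Ico]; omega
  have hD3 : k ∈ Ico (aT n 3) (bT n 3) := by simp [mem_Ico]; omega
  have hm : multT (aT n) (bT n) k = 2 := (multT_partner k).2.1 (by omega) h2
  have hB0 : ∀ l ∈ Ico (bT n 0) (aT n 0), l ≠ 2 * k := fun l hl => by simp [mem_Ico] at hl; omega
  have hB1 : ∀ i ∈ Ico (bT n 1) (aT n 1), i ≠ k := fun i hi => by simp [mem_Ico] at hi; omega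
  have hnum : (numT (aT n) (bT n)).eval (-(k : ℚ)) ≠ 0 := by
    rw [eval_numT_partner]
    refine mul_ne_zero (mul_ne_zero ?_ (prod_ne_zero_iff.2 fun l hl h => hB0 l hl ?_))
      (prod_ne_zero_iff.2 fun i hi h => hB1 i hi ?_)
    · unfold normT facZ; positivity
    · have : ((l : ℤ) : ℚ) = ((2 * k : ℤ) : ℚ) := by linarith
      exact_mod_cast this
    · have : ((i : ℤ) : ℚ) = ((k : ℤ) : ℚ) := by linarith
      exact_mod_cast this
  have hden := eval_dhatT_ne_zero hD2 hD3
  have hA : padicNorm p (coefAT (aT n) (bT n) k) ≤ (p : ℚ) ^ (-EZ p n k) := padicNorm_coefAT_le hn h1 h2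
  -- no factor value is divisible by p
  have hN0 : ∀ l ∈ Ico (bT n 0) (aT n 0), ¬ (p : ℤ) ^ (0 + 1) ∣ l - 2 * k := by
    intro l hl hdvd
    simp [mem_Ico] at hl
    rw [zero_add, pow_one] at hdvd
    obtain ⟨c, hc⟩ := hdvd
    -- 2k − l = p·(−c) with 2k−32n−1 ≤ 2k − l ≤ 2k−15n−2
    exact no_mult_between hpz d0 (c := -c) (by nlinarith) (by nlinarith)
  have hN1 : ∀ i ∈ Ico (bT n 1) (aT n 1), (i - k) ≠ 0 ∧ ¬ (p : ℤ) ^ (0 + 1) ∣ i - k := by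
    intro i hi
    simp [mem_Ico] at hi
    refine ⟨by omega, fun hdvd => ?_⟩
    rw [zero_add, pow_one] at hdvd
    obtain ⟨c, hc⟩ := hdvd
    exact no_mult_between hpz d1 (c := -c) (by nlinarith) (by nlinarith)
  have hN2 : ∀ i ∈ (Ico (aT n 2) (bT n 2)).erase k, (i - k) ≠ 0 ∧ ¬ (p : ℤ) ^ (0 + 1) ∣ i - k := by
    intro i hi
    have hik := ne_of_mem_erase hi; have hi' := mem_of_mem_erase hi
    simp [mem_Ico] at hi'
    refine ⟨by omega, fun hdvd => ?_⟩
    rw [zero_add, pow_one] at hdvd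
    obtain ⟨c, hc⟩ := hdvd
    have e24 : (24 * (n : ℤ) + 1 - k) < 1 * p := by
      have := (Int.ediv_lt_iff_lt_mul hpz).1 (show (24 * (n : ℤ) + 1 - k) / p < 1 by rw [d2.2]; norm_num)
      linarith
    have e13 : (k - (13 * (n : ℤ) + 1)) < 1 * p := by
      have := (Int.ediv_lt_iff_lt_mul hpz).1 (show (k - (13 * (n : ℤ) + 1)) / p < 1 by rw [d2.1]; norm_num)
      linarith
    rcases lt_trichotomy c 0 with hc0 | hc0 | hc0
    · nlinarith
    · subst hc0; simp at hc; exact hik (by linarith)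
    · nlinarith
  have hN3 : ∀ i ∈ (Ico (aT n 3) (bT n 3)).erase k, (i - k) ≠ 0 ∧ ¬ (p : ℤ) ^ (0 + 1) ∣ i - k := by
    intro i hi
    have hik := ne_of_mem_erase hi; have hi' := mem_of_mem_erase hi
    simp [mem_Ico] at hi'
    refine ⟨by omega, fun hdvd => ?_⟩
    rw [zero_add, pow_one] at hdvd
    obtain ⟨c, hc⟩ := hdvd
    have e26 : (26 * (n : ℤ) + 1 - k) < 1 * p := by
      have := (Int.ediv_lt_iff_lt_mul hpz).1 (show (26 * (n : ℤ) + 1 - k) / p < 1 by rw [d3.2]; norm_num)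
      linarith
    have e15 : (k - (15 * (n : ℤ) + 1)) < 1 * p := by
      have := (Int.ediv_lt_iff_lt_mul hpz).1 (show (k - (15 * (n : ℤ) + 1)) / p < 1 by rw [d3.1]; norm_num)
      linarith
    rcases lt_trichotomy c 0 with hc0 | hc0 | hc0
    · nlinarith
    · subst hc0; simp at hc; exact hik (by linarith)
    · nlinarith
  rw [coefBT_of_double hm hnum hden, eval_derivative_numT_eq hB0 hB1, eval_derivative_dhatT_eq,
    mul_div_cancel_left₀ _ hnum, mul_div_cancel_left₀ _ hden, padicNorm.mul]
  rw [show (p : ℚ) ^ (-EZ p n k) = (p : ℚ) ^ (-EZ p n k) * (p : ℚ) ^ ((0 : ℕ) : ℤ) by simp]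
  refine mul_le_mul hA ?_ (padicNorm.nonneg _) (by positivity)
  have two_le : padicNorm p (2 : ℚ) ≤ 1 := by have := padicNorm.of_int (p := p) 2; simpa using this
  have one_le : padicNorm p (1 : ℚ) ≤ 1 := by simp
  have hS0 : padicNorm p (∑ l ∈ Ico (bT n 0) (aT n 0), 2 / ((l : ℚ) - 2 * k)) ≤ (p : ℚ) ^ ((0 : ℕ) : ℤ) := by
    have := padicNorm_sum_inv_le_pow (p := p) (s := Ico (bT n 0) (aT n 0)) 2 two_le (fun l => l - 2 * k) 0
      (fun l hl => ⟨by have := hB0 l hl; omega, hN0 l hl⟩)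
    refine le_of_eq_of_le ?_ this
    congr 1; exact sum_congr rfl fun l _ => by push_cast; ring
  have hS1 : padicNorm p (∑ i ∈ Ico (bT n 1) (aT n 1), 1 / ((i : ℚ) - k)) ≤ (p : ℚ) ^ ((0 : ℕ) : ℤ) := by
    have := padicNorm_sum_inv_le_pow (p := p) (s := Ico (bT n 1) (aT n 1)) 1 one_le (fun i => i - k) 0 hN1
    refine le_of_eq_of_le ?_ this
    congr 1; exact sum_congr rfl fun i _ => by push_cast; ring
  have hS2 : padicNorm p (∑ i ∈ (Ico (aT n 2) (bT n 2)).erase k, 1 / ((i : ℚ) - k)) ≤ (p : ℚ) ^ ((0 : ℕ) : ℤ) := by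
    have := padicNorm_sum_inv_le_pow (p := p) (s := (Ico (aT n 2) (bT n 2)).erase k) 1 one_le
      (fun i => i - k) 0 hN2
    refine le_of_eq_of_le ?_ this
    congr 1; exact sum_congr rfl fun i _ => by push_cast; ring
  have hS3 : padicNorm p (∑ i ∈ (Ico (aT n 3) (bT n 3)).erase k, 1 / ((i : ℚ) - k)) ≤ (p : ℚ) ^ ((0 : ℕ) : ℤ) := by
    have := padicNorm_sum_inv_le_pow (p := p) (s := (Ico (aT n 3) (bT n 3)).erase k) 1 one_le
      (fun i => i - k) 0 hN3
    refine le_of_eq_of_le ?_ this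
    congr 1; exact sum_congr rfl fun i _ => by push_cast; ring
  rw [sub_eq_add_neg]
  calc padicNorm p (∑ l ∈ Ico (bT n 0) (aT n 0), 2 / ((l : ℚ) - 2 * k) + ∑ i ∈ Ico (bT n 1) (aT n 1), 1 / ((i : ℚ) - k)
        + -(∑ i ∈ (Ico (aT n 2) (bT n 2)).erase k, 1 / ((i : ℚ) - k)
          + ∑ i ∈ (Ico (aT n 3) (bT n 3)).erase k, 1 / ((i : ℚ) - k)))
      ≤ max (padicNorm p (∑ l ∈ Ico (bT n 0) (aT n 0), 2 / ((l : ℚ) - 2 * k)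
          + ∑ i ∈ Ico (bT n 1) (aT n 1), 1 / ((i : ℚ) - k)))
        (padicNorm p (-(∑ i ∈ (Ico (aT n 2) (bT n 2)).erase k, 1 / ((i : ℚ) - k)
          + ∑ i ∈ (Ico (aT n 3) (bT n 3)).erase k, 1 / ((i : ℚ) - k)))) := padicNorm.nonarchimedean
    _ ≤ (p : ℚ) ^ ((0 : ℕ) : ℤ) := by
        refine max_le ((padicNorm.nonarchimedean).trans (max_le hS0 hS1)) ?_
        rw [padicNorm.neg]
        exact (padicNorm.nonarchimedean).trans (max_le hS2 hS3)

/-- `‖Σ_{ℓ<m} (−1)^ℓ/(ℓ+1)²‖_p ≤ 1` when `m < p` (no `p` in the denominators). -/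
theorem padicNorm_harmAlt2_le_one {m : ℕ} (hm : m < p) : padicNorm p (harmAlt2 m) ≤ 1 := by
  unfold harmAlt2
  refine padicNorm.sum_le' (fun l hl => ?_) zero_le_one
  have hl' := mem_range.1 hl
  have hs : padicNorm p ((-1 : ℚ) ^ l) ≤ 1 := by
    have := padicNorm.of_int (p := p) ((-1) ^ l); push_cast at this; exact this
  have hne : ((l : ℤ) + 1) ≠ 0 := by omega
  have h1 : padicNorm p (1 / (((l + 1 : ℤ) : ℤ) : ℚ)) ≤ (p : ℚ) ^ ((0 : ℕ) : ℤ) :=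
    padicNorm_inv_int_le_pow (p := p) hne (j := 0) (by
      rw [zero_add, pow_one]
      exact not_pow_dvd_of_natAbs_lt (p := p) hne (m := 1) (by rw [pow_one]; omega) ∘ (by
        intro h; rwa [pow_one]))
  have h1' : padicNorm p (1 / ((l : ℚ) + 1)) ≤ 1 := by push_cast at h1; simpa using h1
  have e : (-1 : ℚ) ^ l / ((l : ℚ) + 1) ^ 2 = (-1) ^ l * (1 / ((l : ℚ) + 1)) * (1 / ((l : ℚ) + 1)) := by
    field_simp
  rw [e, padicNorm.mul, padicNorm.mul]
  calc padicNorm p ((-1 : ℚ) ^ l) * padicNorm p (1 / ((l : ℚ) + 1)) * padicNorm p (1 / ((l : ℚ) + 1))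
      ≤ 1 * 1 * 1 := mul_le_mul (mul_le_mul hs h1' (padicNorm.nonneg _) zero_le_one) h1' (padicNorm.nonneg _)
          (by positivity)
    _ = 1 := by ring

/-- `‖Σ_{ℓ<m} (−1)^ℓ/(ℓ+1)‖_p ≤ 1` when `m < p`. -/
theorem padicNorm_harmAlt1_le_one {m : ℕ} (hm : m < p) : padicNorm p (harmAlt1 m) ≤ 1 := by
  unfold harmAlt1
  refine padicNorm.sum_le' (fun l hl => ?_) zero_le_one
  have hl' := mem_range.1 hl
  have hs : padicNorm p ((-1 : ℚ) ^ l) ≤ 1 := by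
    have := padicNorm.of_int (p := p) ((-1) ^ l); push_cast at this; exact this
  have hne : ((l : ℤ) + 1) ≠ 0 := by omega
  have h1 : padicNorm p (1 / (((l + 1 : ℤ) : ℤ) : ℚ)) ≤ (p : ℚ) ^ ((0 : ℕ) : ℤ) :=
    padicNorm_inv_int_le_pow (p := p) hne (j := 0) (by
      rw [zero_add, pow_one]
      exact not_pow_dvd_of_natAbs_lt (p := p) hne (m := 1) (by rw [pow_one]; omega) ∘ (by
        intro h; rwa [pow_one]))
  have h1' : padicNorm p (1 / ((l : ℚ) + 1)) ≤ 1 := by push_cast at h1; simpa using h1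
  have e : (-1 : ℚ) ^ l / ((l : ℚ) + 1) = (-1) ^ l * (1 / ((l : ℚ) + 1)) := by ring
  rw [e, padicNorm.mul]
  calc padicNorm p ((-1 : ℚ) ^ l) * padicNorm p (1 / ((l : ℚ) + 1)) ≤ 1 * 1 :=
        mul_le_mul hs h1' (padicNorm.nonneg _) zero_le_one
    _ = 1 := one_mul _

/-- **Termwise assembly for `p̂` at the partner of P15**: if every `A`-term (`16n+1 ≤ k ≤ 24n+1`) and every
`B`-term (`15n+1 ≤ k ≤ 26n+1`) of `formPT` has `p`-adic norm `≤ p^e`, then `‖p̂_n‖_p ≤ p^e`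
(outside these ranges the terms vanish: `A_k = 0` on `[15n+1,16n]`, `B_k = 0` on `[13n+1,15n]`). -/
theorem padicNorm_formPT_le_of_termwise (hn : 1 ≤ n) {e : ℤ}
    (hA : ∀ k : ℤ, 16 * (n : ℤ) + 1 ≤ k → k ≤ 24 * (n : ℤ) + 1 →
      padicNorm p (coefAT (aT n) (bT n) k) * padicNorm p (harmAlt2 (2 * k - (26 * (n : ℤ) + 2)).toNat)
        ≤ (p : ℚ) ^ e)
    (hB : ∀ k : ℤ, 15 * (n : ℤ) + 1 ≤ k → k ≤ 26 * (n : ℤ) + 1 →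
      padicNorm p (coefBT (aT n) (bT n) k) * padicNorm p (harmAlt1 (2 * k - (26 * (n : ℤ) + 2)).toNat)
        ≤ (p : ℚ) ^ e) :
    padicNorm p (formPT (aT n) (bT n)) ≤ (p : ℚ) ^ e := by
  have _ := hn
  obtain ⟨hA3, hB2⟩ := range_eq n
  obtain ⟨hMid, hMax, h0s⟩ := rangeB_eq n
  have hsign : padicNorm p (signT (bT n)) = 1 := by
    unfold signT; rcases neg_one_pow_eq_or ℚ (bT n 2 + bT n 3).natAbs with h | h <;> rw [h] <;> simp
  unfold formPT
  rw [padicNorm.mul, hsign, one_mul, hA3, hB2, hMid, hMax, h0s]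
  have two_le : padicNorm p (2 : ℚ) ≤ 1 := by have := padicNorm.of_int (p := p) 2; simpa using this
  have hpe : (0 : ℚ) ≤ (p : ℚ) ^ e := by positivity
  have hA' : ∀ k ∈ Ico (15 * (n : ℤ) + 1) (24 * (n : ℤ) + 2),
      padicNorm p (2 * coefAT (aT n) (bT n) k * harmAlt2 (2 * k - (26 * (n : ℤ) + 2)).toNat) ≤ (p : ℚ) ^ e := by
    intro k hk
    rw [mem_Ico] at hk
    rcases le_or_gt k (16 * (n : ℤ)) with hk16 | hk16
    · rw [coefAT_zoneB1 hk.1 hk16]; simp only [mul_zero, zero_mul, padicNorm.zero]; exact hpe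
    rw [padicNorm.mul, padicNorm.mul]
    calc padicNorm p 2 * padicNorm p (coefAT (aT n) (bT n) k)
          * padicNorm p (harmAlt2 (2 * k - (26 * (n : ℤ) + 2)).toNat)
        ≤ 1 * (padicNorm p (coefAT (aT n) (bT n) k)
          * padicNorm p (harmAlt2 (2 * k - (26 * (n : ℤ) + 2)).toNat)) := by
          rw [mul_assoc]
          exact mul_le_mul_of_nonneg_right two_le (mul_nonneg (padicNorm.nonneg _) (padicNorm.nonneg _))
      _ ≤ (p : ℚ) ^ e := by rw [one_mul]; exact hA k (by omega) (by omega)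
  have hB' : ∀ k ∈ Ico (13 * (n : ℤ) + 1) (26 * (n : ℤ) + 2),
      padicNorm p (coefBT (aT n) (bT n) k * harmAlt1 (2 * k - (26 * (n : ℤ) + 2)).toNat) ≤ (p : ℚ) ^ e := by
    intro k hk
    rw [mem_Ico] at hk
    rcases le_or_gt k (15 * (n : ℤ)) with hk15 | hk15
    · rw [coefBT_zoneA hk.1 hk15]; simp only [zero_mul, padicNorm.zero]; exact hpe
    rw [padicNorm.mul]
    exact hB k (by omega) (by omega)
  exact (padicNorm.nonarchimedean).trans (max_le (padicNorm.sum_le' hA' hpe) (padicNorm.sum_le' hB' hpe))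

end Sharp

end Summit.KontsevichZagierPeriods.Zeta5Search.TwoTaleP15

end
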